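import Summits.CriticalPhenomena.PercolationContinuityZ3.Theorems.PercNearOneGluingNoHeavyLowerTailSahiCombTriWAndProd
import Summits.CriticalPhenomena.PercolationContinuityZ3.Theorems.PercNearOneGluingNoHeavyLowerTailSahiCombTriWCoatoms

/-!
# AND with a majority-of-three block, part 1: the column functions of a family on `2^{γ₁ ⊕ Fin 3}` and their sorted profiles

Support file of the one-cut programme (crux `NoHeavyLowerTail`, stmt-CriticalPhenomena-4575; unit `prim-lf-1` gen 43, memo
`FROM-prim-lf-1-gen43-AND-MAJ3.md`).  Toolkit for `…SahiCombTriWAndMaj3` (the theorem `Cor_{P₁ ∧ maj3} ≥ 0`).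

For a family `A` of the product cube `2^{γ₁ ⊕ Fin 3}` and `x ⊆ γ₁` put `u_A(x) = [x⊔⊤ ∈ A] − [xᶜ⊔⊥ ∈ A]` (`colU`) and, for the three co-atoms
`⊤ − i` of `Fin 3`, `w_{A,i}(x) = [x⊔(⊤−i) ∈ A] − [xᶜ⊔{i} ∈ A]` (`colW`); then `Cor_{P₁ ∧ maj3}(A,B) = Σ_{x∈P₁}[u_Au_B + Σ_i w_{A,i}w_{B,i}]`
(part 2).  This file records, for an up-set `A`: values in `[-1,1]`, monotonicity in `x`, `w_i ≤ u`, and the PAIR CONDITIONS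
`u(x)+u(x') ≥ 0`, `u(x)+w_i(x') ≥ 0`, `w_i(x)+w_j(x') ≥ 0 (i ≠ j)` whenever `x ∪ x' = ⊤`; the sorted profiles `ℓ ≤ m ≤ M` of the three
co-atom columns (`colMin`, `colMed`, `colMax`), the profile vectors `k₁ = u + M` (`profHi`) and `k₂ = ℓ + m` (`profLo`) with their
monotonicity / bounds / pair conditions; the three-pair rearrangement inequality `rearr3` and the certificate identity `cert_identity`
`2(uu' + ℓM' + mm' + Mℓ') = (u+M)(ℓ'+m') + (ℓ+m)(u'+M') + (u−M)[(u'−m')+(u'−ℓ')] + 2(M−m)(u'−m') + (m−ℓ)(u'−M')`.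
HONEST LABEL: complete proofs, std axioms; bookkeeping lemmas only. [this work]
-/

namespace Summit.CriticalPhenomena.PercolationContinuityZ3.Theorems

namespace FiveUpSet

open Finset

variable {β γ₁ : Type} [DecidableEq β] [Fintype β] [DecidableEq γ₁] [Fintype γ₁]

/-! ### The majority-of-three family -/

/-- `maj3 = {y ⊆ Fin 3 | 2 ≤ #y}`. [this work] -/
def maj3 : Finset (Finset (Fin 3)) := univ.filter fun y => 2 ≤ y.card

/-- The four elements of `maj3`. [this work] -/
theorem maj3_eq : maj3 = {univ, univ.erase 0, univ.erase 1, univ.erase 2} := by decide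

/-- `maj3` is an up-set. [this work] -/
theorem isUpperSet_maj3 : IsUpperSet (maj3 : Set (Finset (Fin 3))) := by
  intro y y' hyy' hy
  simp only [maj3, coe_filter, mem_univ, true_and, Set.mem_setOf_eq] at hy ⊢
  exact hy.trans (card_le_card hyy')

/-- `maj3` is antipode free. [this work] -/
theorem disjoint_maj3_refl : Disjoint maj3 (refl maj3) := by decide

/-- `maj3` is self-dual. [this work] -/
theorem maj3_selfDual : ∀ u : Finset (Fin 3), uᶜ ∈ maj3 ↔ u ∉ maj3 := by decide

/-- Summing over `maj3`: the top and the three co-atoms. [this work] -/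
theorem sum_maj3 (f : Finset (Fin 3) → ℤ) : ∑ y ∈ maj3, f y = f univ + ∑ i : Fin 3, f (univ.erase i) := by
  rw [maj3_eq, Fin.sum_univ_three, sum_insert (by decide), sum_insert (by decide), sum_insert (by decide), sum_singleton]
  ring

/-! ### Indicator arithmetic -/

/-- `δ_A(t) = [t ∈ A] − [tᶜ ∈ A]`. [this work] -/
theorem sgnDiff_refl_eq {δ : Type} [DecidableEq δ] [Fintype δ] (A : Finset (Finset δ)) (t : Finset δ) :
    sgnDiff A (refl A) t = ind A t - ind A tᶜ := by
  unfold sgnDiff ind; simp only [mem_refl]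

/-- The indicator of an up-set is monotone in the point. [this work] -/
theorem ind_mono_pt {δ : Type} [DecidableEq δ] {A : Finset (Finset δ)} (hA : IsUpperSet (A : Set (Finset δ))) {s t : Finset δ}
    (h : s ⊆ t) : ind A s ≤ ind A t := by
  unfold ind
  by_cases hs : s ∈ A
  · have ht : t ∈ A := hA h hs
    rw [if_pos hs, if_pos ht]
  · rw [if_neg hs]; split_ifs <;> norm_num

/-- Indicator values are `0` or `1`. [this work] -/
theorem ind_nonneg_le_one {δ : Type} [DecidableEq δ] (A : Finset (Finset δ)) (t : Finset δ) : 0 ≤ ind A t ∧ ind A t ≤ 1 := by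
  unfold ind; split_ifs <;> norm_num

/-! ### The column functions of a family on the product cube `2^{γ₁ ⊕ Fin 3}` -/

/-- Top column: `u_A(x) = [x ⊔ ⊤ ∈ A] − [xᶜ ⊔ ⊥ ∈ A]`. [this work] -/
def colU (A : Finset (Finset (γ₁ ⊕ Fin 3))) (x : Finset γ₁) : ℤ := sgnDiff A (refl A) (x.disjSum univ)

/-- Co-atom column `i`: `w_{A,i}(x) = [x ⊔ (⊤−i) ∈ A] − [xᶜ ⊔ {i} ∈ A]`. [this work] -/
def colW (A : Finset (Finset (γ₁ ⊕ Fin 3))) (i : Fin 3) (x : Finset γ₁) : ℤ := sgnDiff A (refl A) (x.disjSum (univ.erase i))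

/-- The top column as a difference of indicators. [this work] -/
theorem colU_eq (A : Finset (Finset (γ₁ ⊕ Fin 3))) (x : Finset γ₁) :
    colU A x = ind A (x.disjSum univ) - ind A (xᶜ.disjSum ∅) := by
  unfold colU; rw [sgnDiff_refl_eq, compl_disjSum, compl_univ]

/-- The co-atom column as a difference of indicators. [this work] -/
theorem colW_eq (A : Finset (Finset (γ₁ ⊕ Fin 3))) (i : Fin 3) (x : Finset γ₁) :
    colW A i x = ind A (x.disjSum (univ.erase i)) - ind A (xᶜ.disjSum {i}) := by
  unfold colW; rw [sgnDiff_refl_eq, compl_disjSum]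
  congr 2; ext j; simp

section colfacts
variable {A : Finset (Finset (γ₁ ⊕ Fin 3))} (hA : IsUpperSet (A : Set (Finset (γ₁ ⊕ Fin 3))))
include hA

/-- The top column is increasing. [this work] -/
theorem colU_mono {x x' : Finset γ₁} (h : x ⊆ x') : colU A x ≤ colU A x' := by
  rw [colU_eq, colU_eq]
  have h1 := ind_mono_pt hA (disjSum_mono h (le_refl (univ : Finset (Fin 3))))
  have h2 := ind_mono_pt hA (disjSum_mono (compl_subset_compl.2 h) (le_refl (∅ : Finset (Fin 3))))
  linarith

/-- The co-atom columns are increasing. [this work] -/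
theorem colW_mono (i : Fin 3) {x x' : Finset γ₁} (h : x ⊆ x') : colW A i x ≤ colW A i x' := by
  rw [colW_eq, colW_eq]
  have h1 := ind_mono_pt hA (disjSum_mono h (le_refl (univ.erase i : Finset (Fin 3))))
  have h2 := ind_mono_pt hA (disjSum_mono (compl_subset_compl.2 h) (le_refl ({i} : Finset (Fin 3))))
  linarith

/-- Each co-atom column is dominated by the top column. [this work] -/
theorem colW_le_colU (i : Fin 3) (x : Finset γ₁) : colW A i x ≤ colU A x := by
  rw [colW_eq, colU_eq]
  have h1 := ind_mono_pt hA (disjSum_mono (le_refl x) (erase_subset i (univ : Finset (Fin 3))))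
  have h2 := ind_mono_pt hA (disjSum_mono (le_refl xᶜ) (empty_subset ({i} : Finset (Fin 3))))
  linarith

omit hA in
/-- Values of the top column lie in `[-1,1]`. [this work] -/
theorem colU_bounds (x : Finset γ₁) : -1 ≤ colU A x ∧ colU A x ≤ 1 := by
  rw [colU_eq]
  have h1 := ind_nonneg_le_one A (x.disjSum (univ : Finset (Fin 3)))
  have h2 := ind_nonneg_le_one A (xᶜ.disjSum (∅ : Finset (Fin 3)))
  constructor <;> linarith

omit hA in
/-- Values of the co-atom columns lie in `[-1,1]`. [this work] -/
theorem colW_bounds (i : Fin 3) (x : Finset γ₁) : -1 ≤ colW A i x ∧ colW A i x ≤ 1 := by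
  rw [colW_eq]
  have h1 := ind_nonneg_le_one A (x.disjSum (univ.erase i : Finset (Fin 3)))
  have h2 := ind_nonneg_le_one A (xᶜ.disjSum ({i} : Finset (Fin 3)))
  constructor <;> linarith

/-- Pair condition for the top column: `x ∪ x' = ⊤ ⟹ u(x) + u(x') ≥ 0`. [this work] -/
theorem colU_add_colU_nonneg {x x' : Finset γ₁} (h : x ∪ x' = univ) : 0 ≤ colU A x + colU A x' := by
  rw [colU_eq, colU_eq]
  have hc : xᶜ ⊆ x' := by
    intro a ha; rw [mem_compl] at ha
    have := mem_univ a; rw [← h, mem_union] at this; tauto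
  have hc' : x'ᶜ ⊆ x := by
    intro a ha; rw [mem_compl] at ha
    have := mem_univ a; rw [← h, mem_union] at this; tauto
  have h1 := ind_mono_pt hA (disjSum_mono hc (empty_subset (univ : Finset (Fin 3))))
  have h2 := ind_mono_pt hA (disjSum_mono hc' (empty_subset (univ : Finset (Fin 3))))
  linarith

/-- Pair condition top/co-atom: `x ∪ x' = ⊤ ⟹ u(x) + w_i(x') ≥ 0`. [this work] -/
theorem colU_add_colW_nonneg (i : Fin 3) {x x' : Finset γ₁} (h : x ∪ x' = univ) : 0 ≤ colU A x + colW A i x' := by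
  rw [colU_eq, colW_eq]
  have hc : xᶜ ⊆ x' := by
    intro a ha; rw [mem_compl] at ha
    have := mem_univ a; rw [← h, mem_union] at this; tauto
  have hc' : x'ᶜ ⊆ x := by
    intro a ha; rw [mem_compl] at ha
    have := mem_univ a; rw [← h, mem_union] at this; tauto
  have h1 := ind_mono_pt hA (disjSum_mono hc (empty_subset (univ.erase i : Finset (Fin 3))))
  have h2 := ind_mono_pt hA (disjSum_mono hc' (subset_univ ({i} : Finset (Fin 3))))
  linarith

/-- Pair condition between DIFFERENT co-atom columns: `x ∪ x' = ⊤, i ≠ j ⟹ w_i(x) + w_j(x') ≥ 0`. [this work] -/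
theorem colW_add_colW_nonneg {i j : Fin 3} (hij : i ≠ j) {x x' : Finset γ₁} (h : x ∪ x' = univ) :
    0 ≤ colW A i x + colW A j x' := by
  rw [colW_eq, colW_eq]
  have hc : xᶜ ⊆ x' := by
    intro a ha; rw [mem_compl] at ha
    have := mem_univ a; rw [← h, mem_union] at this; tauto
  have hc' : x'ᶜ ⊆ x := by
    intro a ha; rw [mem_compl] at ha
    have := mem_univ a; rw [← h, mem_union] at this; tauto
  have hi : ({i} : Finset (Fin 3)) ⊆ univ.erase j := by
    intro a ha; rw [mem_singleton] at ha; rw [ha]; exact mem_erase.2 ⟨hij, mem_univ i⟩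
  have hj : ({j} : Finset (Fin 3)) ⊆ univ.erase i := by
    intro a ha; rw [mem_singleton] at ha; rw [ha]; exact mem_erase.2 ⟨fun h => hij h.symm, mem_univ j⟩
  have h1 := ind_mono_pt hA (disjSum_mono hc hi)
  have h2 := ind_mono_pt hA (disjSum_mono hc' hj)
  linarith

end colfacts

/-! ### Sorted profiles of the three co-atom columns -/

/-- Pointwise minimum of the three co-atom columns. [this work] -/
def colMin (A : Finset (Finset (γ₁ ⊕ Fin 3))) (x : Finset γ₁) : ℤ := min (min (colW A 0 x) (colW A 1 x)) (colW A 2 x)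

/-- Pointwise maximum of the three co-atom columns. [this work] -/
def colMax (A : Finset (Finset (γ₁ ⊕ Fin 3))) (x : Finset γ₁) : ℤ := max (max (colW A 0 x) (colW A 1 x)) (colW A 2 x)

/-- Pointwise median of the three co-atom columns (sum minus min minus max). [this work] -/
def colMed (A : Finset (Finset (γ₁ ⊕ Fin 3))) (x : Finset γ₁) : ℤ :=
  colW A 0 x + colW A 1 x + colW A 2 x - colMin A x - colMax A x

/-- First profile vector `k₁ = u + M` (top column plus maximum). [this work] -/
def profHi (A : Finset (Finset (γ₁ ⊕ Fin 3))) (x : Finset γ₁) : ℤ := colU A x + colMax A x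

/-- Second profile vector `k₂ = ℓ + m` (the two smallest co-atom values). [this work] -/
def profLo (A : Finset (Finset (γ₁ ⊕ Fin 3))) (x : Finset γ₁) : ℤ := colMin A x + colMed A x

set_option maxHeartbeats 400000 in
/-- **Rearrangement for three pairs** (values in `[-1,1]`): `Σ_i a_i b_i ≥ ℓ_a M_b + m_a m_b + M_a ℓ_b`. [this work] -/
theorem rearr3 (a0 a1 a2 b0 b1 b2 : ℤ) (h0 : -1 ≤ a0) (h0' : a0 ≤ 1) (h1 : -1 ≤ a1) (h1' : a1 ≤ 1) (h2 : -1 ≤ a2) (h2' : a2 ≤ 1) :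
    min (min a0 a1) a2 * max (max b0 b1) b2
      + (a0 + a1 + a2 - min (min a0 a1) a2 - max (max a0 a1) a2) * (b0 + b1 + b2 - min (min b0 b1) b2 - max (max b0 b1) b2)
      + max (max a0 a1) a2 * min (min b0 b1) b2
    ≤ a0 * b0 + a1 * b1 + a2 * b2 := by
  interval_cases a0 <;> interval_cases a1 <;> interval_cases a2 <;> simp only [min_def, max_def] <;> split_ifs <;> omega

/-- The polynomial identity behind the certificate. [this work] -/
theorem cert_identity (u l m M v l' m' M' : ℤ) :
    2 * (u * v + l * M' + m * m' + M * l')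
      = (u + M) * (l' + m') + (l + m) * (v + M') + (u - M) * ((v - m') + (v - l')) + 2 * ((M - m) * (v - m')) + (m - l) * (v - M') := by
  ring

section profilefacts
variable {A : Finset (Finset (γ₁ ⊕ Fin 3))} (hA : IsUpperSet (A : Set (Finset (γ₁ ⊕ Fin 3))))
include hA

omit hA in
/-- `ℓ ≤ m`. [this work] -/
theorem colMin_le_colMed (x : Finset γ₁) : colMin A x ≤ colMed A x := by
  unfold colMed colMin colMax; simp only [min_def, max_def]; split_ifs <;> omega

omit hA in
/-- `m ≤ M`. [this work] -/
theorem colMed_le_colMax (x : Finset γ₁) : colMed A x ≤ colMax A x := by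
  unfold colMed colMin colMax; simp only [min_def, max_def]; split_ifs <;> omega

/-- `M ≤ u`. [this work] -/
theorem colMax_le_colU (x : Finset γ₁) : colMax A x ≤ colU A x := by
  unfold colMax
  have h0 := colW_le_colU hA 0 x; have h1 := colW_le_colU hA 1 x; have h2 := colW_le_colU hA 2 x
  simp only [max_def]; split_ifs <;> omega

/-- `k₁ = u + M` is increasing. [this work] -/
theorem profHi_mono {x x' : Finset γ₁} (h : x ⊆ x') : profHi A x ≤ profHi A x' := by
  unfold profHi colMax
  have hu := colU_mono hA h; have h0 := colW_mono hA 0 h; have h1 := colW_mono hA 1 h; have h2 := colW_mono hA 2 h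
  simp only [max_def]; split_ifs <;> omega

/-- `k₂ = ℓ + m` is increasing. [this work] -/
theorem profLo_mono {x x' : Finset γ₁} (h : x ⊆ x') : profLo A x ≤ profLo A x' := by
  unfold profLo colMed colMin colMax
  have h0 := colW_mono hA 0 h; have h1 := colW_mono hA 1 h; have h2 := colW_mono hA 2 h
  simp only [min_def, max_def]; split_ifs <;> omega

omit hA in
/-- `k₁ ∈ [-2,2]`. [this work] -/
theorem profHi_bounds (x : Finset γ₁) : -2 ≤ profHi A x ∧ profHi A x ≤ 2 := by
  unfold profHi colMax
  have hu := colU_bounds (A := A) x; have h0 := colW_bounds (A := A) 0 x; have h1 := colW_bounds (A := A) 1 x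
  have h2 := colW_bounds (A := A) 2 x
  simp only [max_def]; split_ifs <;> omega

omit hA in
/-- `k₂ ∈ [-2,2]`. [this work] -/
theorem profLo_bounds (x : Finset γ₁) : -2 ≤ profLo A x ∧ profLo A x ≤ 2 := by
  unfold profLo colMed colMin colMax
  have h0 := colW_bounds (A := A) 0 x; have h1 := colW_bounds (A := A) 1 x; have h2 := colW_bounds (A := A) 2 x
  simp only [min_def, max_def]; split_ifs <;> omega

/-- Pair condition for `k₁ = u + M`. [this work] -/
theorem profHi_pair {x x' : Finset γ₁} (h : x ∪ x' = univ) : 0 ≤ profHi A x + profHi A x' := by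
  unfold profHi colMax
  have hu := colU_add_colU_nonneg hA h
  have h01 := colW_add_colW_nonneg hA (i := 0) (j := 1) (by decide) h
  have h02 := colW_add_colW_nonneg hA (i := 0) (j := 2) (by decide) h
  have h10 := colW_add_colW_nonneg hA (i := 1) (j := 0) (by decide) h
  have h12 := colW_add_colW_nonneg hA (i := 1) (j := 2) (by decide) h
  have h20 := colW_add_colW_nonneg hA (i := 2) (j := 0) (by decide) h
  have h21 := colW_add_colW_nonneg hA (i := 2) (j := 1) (by decide) h
  simp only [max_def]; split_ifs <;> omega

/-- Pair condition for `k₂ = ℓ + m` (the two smallest at `x` against the two smallest at `x'`). [this work] -/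
theorem profLo_pair {x x' : Finset γ₁} (h : x ∪ x' = univ) : 0 ≤ profLo A x + profLo A x' := by
  unfold profLo colMed colMin colMax
  have h01 := colW_add_colW_nonneg hA (i := 0) (j := 1) (by decide) h
  have h02 := colW_add_colW_nonneg hA (i := 0) (j := 2) (by decide) h
  have h10 := colW_add_colW_nonneg hA (i := 1) (j := 0) (by decide) h
  have h12 := colW_add_colW_nonneg hA (i := 1) (j := 2) (by decide) h
  have h20 := colW_add_colW_nonneg hA (i := 2) (j := 0) (by decide) h
  have h21 := colW_add_colW_nonneg hA (i := 2) (j := 1) (by decide) h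
  simp only [min_def, max_def]; split_ifs <;> omega

end profilefacts

end FiveUpSet

end Summit.CriticalPhenomena.PercolationContinuityZ3.Theorems
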